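import Summits.CriticalPhenomena.PercolationContinuityZ3.Theorems.PercNearOneGluingNoHeavyLowerTailOneCutCertGraph

/-!
# `NoHeavyLowerTail` (crux stmt-CriticalPhenomena-4575), certificate programme for the one-cut bound at
# `|A| = 5`: compact certificate data and their expansion

Layer 5 of the kernel-checked certificate checker (prim-cert-2): the certificates found by linear
programming are symmetric under the vertex permutations fixing the observer, the relay set and the box;
they are stored by ONE representative `(pair, copy-configuration mask, value)` per orbit in a string, and
`expandLam` / `expandC` rebuild the full multiplier tables (lists of length `2^m`) by applying the listed
permutations.  This is pure data plumbing: `boxCheck_sound` holds for ANY nonnegative tables, so nothing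
about orbits needs to be proved.

Nothing here asserts anything about the crux.
-/

namespace Summit.CriticalPhenomena.PercolationContinuityZ3.Theorems.OneCutCert

open Summit.CriticalPhenomena.PercolationContinuityZ3.Theorems.AdditiveGluing.Negative.Cert

/-- Parse a whitespace-separated list of naturals. [this work] -/
def parseNats (s : String) : List ℕ :=
  ((s.splitOn " ").filter fun t => t ≠ "").map String.toNat!

/-- Group a flat list into triples. [this work] -/
def triples : List ℕ → List (ℕ × ℕ × ℕ)
  | a :: b :: c :: l => (a, b, c) :: triples l
  | _ => []

/-- Group a flat list into pairs. [this work] -/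
def pairsOf : List ℕ → List (ℕ × ℕ)
  | a :: b :: l => (a, b) :: pairsOf l
  | _ => []

/-- Parse a `;`-separated list of `,`-separated vertex permutations. [this work] -/
def parseGroup (s : String) : List (List ℕ) :=
  (s.splitOn ";").map fun t => ((t.splitOn ",").filter fun u => u ≠ "").map String.toNat!

/-- Image of a vertex under a permutation given as the list of images. [this work] -/
def permV (π : List ℕ) (v : ℕ) : ℕ := π.getD v v

/-- Index of the unordered pair `{a, b}` in `allPairs n` (as naturals). [this work] -/
def edgeIdx (n a b : ℕ) : ℕ :=
  (allPairs n).findIdx fun p => p.1.val == min a b && p.2.val == max a b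

/-- Image of a copy-configuration mask under a vertex permutation. [this work] -/
def permMask (n : ℕ) (π : List ℕ) (v : ℕ) : ℕ :=
  (List.range (mE n)).foldl (fun acc i =>
    if v.testBit i then
      match (allPairs n)[i]? with
      | some e => acc ||| 2 ^ edgeIdx n (permV π e.1.val) (permV π e.2.val)
      | none => acc
    else acc) 0

/-- Index of the unordered pair `{a, b}` in a pair list (as naturals). [this work] -/
def pairIdx (pairs : List (ℕ × ℕ)) (a b : ℕ) : ℕ :=
  pairs.findIdx fun p => p.1 == min a b && p.2 == max a b

/-- Expand compact multiplier entries `(pair, mask, value)` to full tables by the symmetry group. [this work] -/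
def expandLam (n : ℕ) (pairs : List (ℕ × ℕ)) (group : List (List ℕ)) (entries : List (ℕ × ℕ × ℕ)) :
    List (List ℕ) :=
  let K := 2 ^ mE n
  let init : Array (Array ℕ) := Array.replicate pairs.length (Array.replicate K 0)
  let arr := entries.foldl (fun acc e =>
    group.foldl (fun acc π =>
      let ab := pairs.getD e.1 (0, 0)
      let p' := pairIdx pairs (permV π ab.1) (permV π ab.2)
      let v' := permMask n π e.2.1
      acc.modify p' fun row => row.setIfInBounds v' e.2.2) acc) init
  (arr.map Array.toList).toList

/-- Expand compact hypothesis-multiplier entries `(mask, value)` to a full table. [this work] -/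
def expandC (n : ℕ) (group : List (List ℕ)) (entries : List (ℕ × ℕ)) : List ℕ :=
  let K := 2 ^ mE n
  let arr := entries.foldl (fun acc e =>
    group.foldl (fun acc π => acc.setIfInBounds (permMask n π e.1) e.2) acc) (Array.replicate K 0)
  arr.toList

/-- Expand compact multiplier entries `(pair, low-mask, value)` that are CONSTANT in the coordinates
`≥ kLow` (multipliers depending on the first `kLow` coordinates only, e.g. the o-edges): every mask
`v` with `v &&& (2^kLow - 1) = low-mask` gets the value, for every image under the group. [this work] -/
def expandLamV (n : ℕ) (pairs : List (ℕ × ℕ)) (group : List (List ℕ)) (kLow : ℕ)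
    (entries : List (ℕ × ℕ × ℕ)) : List (List ℕ) :=
  let K := 2 ^ mE n
  let R := List.range (2 ^ (mE n - kLow))
  let init : Array (Array ℕ) := Array.replicate pairs.length (Array.replicate K 0)
  let arr := entries.foldl (fun acc e =>
    group.foldl (fun acc π =>
      let ab := pairs.getD e.1 (0, 0)
      let p' := pairIdx pairs (permV π ab.1) (permV π ab.2)
      let v' := permMask n π e.2.1
      acc.modify p' fun row => R.foldl (fun row r => row.setIfInBounds (v' ||| (r <<< kLow)) e.2.2) row) acc) init
  (arr.map Array.toList).toList

/-- Expand compact hypothesis-multiplier entries `(low-mask, value)` constant in the coordinates `≥ kLow`. [this work] -/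
def expandCV (n : ℕ) (group : List (List ℕ)) (kLow : ℕ) (entries : List (ℕ × ℕ)) : List ℕ :=
  let K := 2 ^ mE n
  let R := List.range (2 ^ (mE n - kLow))
  let arr := entries.foldl (fun acc e =>
    group.foldl (fun acc π =>
      let v' := permMask n π e.1
      R.foldl (fun acc r => acc.setIfInBounds (v' ||| (r <<< kLow)) e.2) acc) acc) (Array.replicate K 0)
  arr.toList

/-- Scatter the bits of `r` to the coordinate positions `pos` (bit `j` of `r` ↦ bit `pos[j]`). [this work] -/
def scatterBits (pos : List ℕ) (r : ℕ) : ℕ :=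
  (pos.zipIdx).foldl (fun acc q => if r.testBit q.2 then acc ||| 2 ^ q.1 else acc) 0

/-- Expand compact multiplier entries `(pair, V'-mask, value)` for multipliers depending only on the
coordinates listed in `vpos` (the mask is already placed at those positions): every completion on the
remaining coordinates gets the value, for every image under the group. [this work] -/
def expandLamS (n : ℕ) (pairs : List (ℕ × ℕ)) (group : List (List ℕ)) (vpos : List ℕ)
    (entries : List (ℕ × ℕ × ℕ)) : List (List ℕ) :=
  let K := 2 ^ mE n
  let rest := (List.range (mE n)).filter fun i => ¬ i ∈ vpos
  let fills := (List.range (2 ^ rest.length)).map (scatterBits rest)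
  let init : Array (Array ℕ) := Array.replicate pairs.length (Array.replicate K 0)
  let arr := entries.foldl (fun acc e =>
    group.foldl (fun acc π =>
      let ab := pairs.getD e.1 (0, 0)
      let p' := pairIdx pairs (permV π ab.1) (permV π ab.2)
      let v' := permMask n π e.2.1
      acc.modify p' fun row => fills.foldl (fun row f => row.setIfInBounds (v' ||| f) e.2.2) row) acc) init
  (arr.map Array.toList).toList

/-- Expand compact hypothesis-multiplier entries `(V'-mask, value)` constant off `vpos`. [this work] -/
def expandCS (n : ℕ) (group : List (List ℕ)) (vpos : List ℕ) (entries : List (ℕ × ℕ)) : List ℕ :=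
  let K := 2 ^ mE n
  let rest := (List.range (mE n)).filter fun i => ¬ i ∈ vpos
  let fills := (List.range (2 ^ rest.length)).map (scatterBits rest)
  let arr := entries.foldl (fun acc e =>
    group.foldl (fun acc π =>
      let v' := permMask n π e.1
      fills.foldl (fun acc f => acc.setIfInBounds (v' ||| f) e.2) acc) acc) (Array.replicate K 0)
  arr.toList

/-- The box pattern of a string over `F/L/H` (coordinate `i` = character `i`). [this work] -/
def boxOfString (s : String) (m : ℕ) (i : Fin m) : Fin 3 :=
  match s.toList.getD i.val 'F' with
  | 'L' => 1
  | 'H' => 2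
  | _ => 0

end Summit.CriticalPhenomena.PercolationContinuityZ3.Theorems.OneCutCert
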